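import Literature.Analysis.FunctionSpaces.SpinorWightmanVanishing
import Literature.MathematicalPhysics.QuantumLattice.TubeBoostPCT
import HarnessLib

/-!
# Spinor Wightman fields: weak local commutativity at wedge configurations (the locality input of
the PCT theorem)

Topic `Literature/Analysis/FunctionSpaces`, on the way to `Literature.Analysis.FunctionSpaces.pct_theorem`
(Streater–Wightman (1964), §4-3, Thm. 4-7: "every field theory of fields with normal commutation
relations has … weak local commutativity", the hypothesis of the theorem). Three independent pieces:

* **The sign.** `fermiPairSign bs` is the sign picked up when a product of fields with Fermi flags
  `bs` is written in the reverse order using normal commutation relations: the product over all pairs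
  of `−1` for each pair of Fermi fields, `(−1)^{F(F−1)/2}` with `F` the number of Fermi flags
  (`fermiPairSign_eq_pow`).
* **Reversal of a monomial with pairwise spacelike separated letters** (W3± iterated,
  `IsSpinorWightmanQFT.cMonomial_eq_smul_reverse`): `φ(l) ψ = σ · φ(l.reverse) ψ` with
  `σ = fermiPairSign`; hence for the Wightman functions
  `𝒲_{k,α}(f) = σ · 𝒲_{k∘rev, α∘rev}(f ∘ rev)` (`wightmanFn_eq_fermiPairSign_mul_reverse`) — this is
  weak local commutativity (S–W eq. (4-21)/(4-33)) at the level of smeared functions.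
* **Geometry of wedge configurations and locality of test functions**: inside a box
  `{x | xⱼ ∈ Bⱼ}` of right-wedge configurations (`TubeBoost.rightWedgeConfigs`) any two slots are
  separated by the right wedge `W_R`, hence spacelike separated, and so are their reflections
  (`areSpacelikeSeparated_of_box_subset`); and the **local totality of tensor products**
  (`clm_eq_zero_of_tsupport_subset_box`): a continuous functional on `𝒮((ℝ⁴)ⁿ)` vanishing on the
  tensor products of compactly supported test functions supported in the `Bⱼ` vanishes on every
  compactly supported test function supported in the box (cutoffs and the density of tensor
  products, as `IsSpinorVectorDistributionOf.apply_eq_zero_of_tsupport_subset_pi`).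

## References

* R. F. Streater, A. S. Wightman, *PCT, Spin and Statistics, and All That* (1964; Princeton 2000),
  §3-1 eq. (3-6), §4-3 Thm. 4-7 and eqs. (4-21), (4-33). [StreaterWightman1964]
-/

noncomputable section

open Filter MeasureTheory Set ComplexConjugate Complex
open _root_.Topology
open scoped InnerProductSpace SchwartzMap ContDiff
open Literature.MathematicalPhysics.QuantumLattice

namespace Literature.Analysis.FunctionSpaces

variable {κ : Type*}

/-! ### The sign of a reversal -/

/-- The **sign of reversing a product of fields with Fermi flags `bs`** under normal commutation
relations: `−1` for every pair of Fermi fields. [cite: StreaterWightman1964, §4-3 eq. (4-33)] -/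
def fermiPairSign : List Bool → ℂ
  | [] => 1
  | b :: l => (l.map fun b' => if (b && b') = true then (-1 : ℂ) else 1).prod * fermiPairSign l

/-- `fermiPairSign [] = 1`. [folklore] -/
@[simp] theorem fermiPairSign_nil : fermiPairSign [] = 1 := rfl

/-- The recursion of `fermiPairSign`. [folklore] -/
@[simp] theorem fermiPairSign_cons (b : Bool) (l : List Bool) :
    fermiPairSign (b :: l) = (l.map fun b' => if (b && b') = true then (-1 : ℂ) else 1).prod * fermiPairSign l := rfl

/-- The factor of a Fermi field passing through a list: `(−1)^{#Fermi}`. [folklore] -/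
theorem prod_map_ite_and (b : Bool) (l : List Bool) :
    (l.map fun b' => if (b && b') = true then (-1 : ℂ) else 1).prod = if b then (-1) ^ (l.count true) else 1 := by
  induction l with
  | nil => simp
  | cons b' l ih =>
    rw [List.map_cons, List.prod_cons, ih, List.count_cons]
    cases b <;> cases b' <;> simp [pow_succ]

/-- **`fermiPairSign = (−1)^{F(F−1)/2}`** with `F` the number of Fermi flags. [cite: StreaterWightman1964, §4-3 eq. (4-33)] -/
theorem fermiPairSign_eq_pow (l : List Bool) : fermiPairSign l = (-1) ^ Nat.choose (l.count true) 2 := by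
  induction l with
  | nil => simp
  | cons b l ih =>
    rw [fermiPairSign_cons, prod_map_ite_and, ih, List.count_cons]
    cases b
    · simp
    · simp only [↓reduceIte, beq_self_eq_true, Nat.choose_succ_succ', Nat.choose_one_right, pow_add]

/-- Pascal's rule at `k = 2`: `C(n+1, 2) = C(n, 2) + n`. [folklore] -/
theorem choose_two_succ (n : ℕ) : Nat.choose (n + 1) 2 = Nat.choose n 2 + n := by
  rw [Nat.choose_two_right, Nat.choose_two_right, Nat.add_sub_cancel]
  rcases Nat.even_or_odd n with ⟨r, hr⟩ | ⟨r, hr⟩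
  · subst hr
    rw [show (r + r) * (r + r - 1) = 2 * (r * (r + r - 1)) by ring, show (r + r + 1) * (r + r) = 2 * (r * (r + r + 1)) by ring,
      Nat.mul_div_cancel_left _ (by norm_num : 0 < 2), Nat.mul_div_cancel_left _ (by norm_num : 0 < 2)]
    rcases Nat.eq_zero_or_pos r with rfl | hr0
    · simp
    · have : r + r - 1 + 2 = r + r + 1 := by omega
      nlinarith [this]
  · subst hr
    rw [show (2 * r + 1) * (2 * r + 1 - 1) = 2 * (r * (2 * r + 1)) by rw [Nat.add_sub_cancel]; ring,
      show (2 * r + 1 + 1) * (2 * r + 1) = 2 * ((r + 1) * (2 * r + 1)) by ring,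
      Nat.mul_div_cancel_left _ (by norm_num : 0 < 2), Nat.mul_div_cancel_left _ (by norm_num : 0 < 2)]
    ring

/-- `(−1)^{C(2m, 2)} = (−1)^m` and `(−1)^{C(2m+1, 2)} = (−1)^m`. [folklore] -/
theorem neg_one_pow_choose_two_mul (m : ℕ) :
    (-1 : ℂ) ^ Nat.choose (2 * m) 2 = (-1) ^ m ∧ (-1 : ℂ) ^ Nat.choose (2 * m + 1) 2 = (-1) ^ m := by
  induction m with
  | zero => simp
  | succ p ih =>
    have h1 : (-1 : ℂ) ^ Nat.choose (2 * (p + 1)) 2 = (-1) ^ (p + 1) := by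
      rw [show 2 * (p + 1) = (2 * p + 1) + 1 by ring, choose_two_succ, pow_add, ih.2, pow_succ, pow_succ, pow_mul, neg_one_sq,
        one_pow, one_mul]
    refine ⟨h1, ?_⟩
    rw [choose_two_succ, pow_add, h1, show 2 * (p + 1) = 2 * (p + 1) from rfl, pow_mul, neg_one_sq, one_pow, mul_one]

/-- For an even number `F = 2m` of Fermi flags the sign is `i^F`: `(−1)^{m(2m−1)} = (−1)^m = i^{2m}`.
[cite: StreaterWightman1964, §4-3 Thm 4-7] -/
theorem fermiPairSign_eq_I_pow_of_even (l : List Bool) (h : Even (l.count true)) :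
    fermiPairSign l = I ^ (l.count true) := by
  obtain ⟨m, hm⟩ := h
  rw [fermiPairSign_eq_pow, hm, ← two_mul, (neg_one_pow_choose_two_mul m).1, pow_mul, I_sq]

namespace IsSpinorWightmanQFT

open SpinorWightmanData

variable {W : SpinorWightmanData κ}

/-! ### Reversal of a monomial with pairwise spacelike separated letters -/

/-- The letter-level sign equals `fermiPairSign` of the flags. [folklore] -/
theorem prod_map_localitySign (i : W.Idx) (l : List W.CLetter) :
    (l.map fun p => W.localitySign i p.1).prod =
      ((l.map fun p => W.isFermi p.1.1).map fun b' => if (W.isFermi i.1 && b') = true then (-1 : ℂ) else 1).prod := by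
  rw [List.map_map]
  rfl

/-- **Reversing a monomial of pairwise spacelike separated letters** (W3± iterated):
`φ(l) ψ = σ · φ(l.reverse) ψ`, `σ = fermiPairSign` of the flags of `l`. [cite: StreaterWightman1964, §3-1 eq. (3-6); §4-3 eq. (4-33)] -/
theorem cMonomial_eq_smul_reverse (hW : IsSpinorWightmanQFT W) (l : List W.CLetter)
    (h : l.Pairwise fun p q => AreSpacelikeSeparated (tsupport (p.2 : SpaceTime 3 → ℂ)) (tsupport (q.2 : SpaceTime 3 → ℂ)))
    (ψ : W.dom) :
    W.cMonomial l ψ = fermiPairSign (l.map fun p => W.isFermi p.1.1) • W.cMonomial l.reverse ψ := by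
  induction l generalizing ψ with
  | nil => simp
  | cons p l ih =>
    rw [List.pairwise_cons] at h
    have hsep : ∀ q ∈ l.reverse, AreSpacelikeSeparated (tsupport (p.2 : SpaceTime 3 → ℂ)) (tsupport (q.2 : SpaceTime 3 → ℂ)) :=
      fun q hq => h.1 q (List.mem_reverse.1 hq)
    rw [cMonomial_cons, LinearMap.comp_apply, ih h.2, map_smul, hW.cfield_cMonomial_comm p.1 p.2 l.reverse ψ hsep,
      smul_smul, List.reverse_cons, W.cMonomial_append]
    simp only [List.map_cons, fermiPairSign_cons, cMonomial_cons, cMonomial_nil, LinearMap.comp_apply, LinearMap.id_apply]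
    congr 1
    rw [prod_map_localitySign, List.map_reverse, List.map_reverse, List.prod_reverse, mul_comm]

/-- The flags of a tuple of letters. [folklore] -/
theorem map_isFermi_ofFn {n : ℕ} (i : Fin n → W.Idx) (f : Fin n → 𝓢(SpaceTime 3, ℂ)) :
    ((List.ofFn fun j => (i j, f j)).map fun p : W.CLetter => W.isFermi p.1.1) = List.ofFn fun j => W.isFermi (i j).1 := by
  rw [List.map_ofFn]; rfl

/-- **Weak local commutativity of the Wightman functions at totally spacelike smearing**
(Streater–Wightman (1964), eq. (4-33), smeared): if the test functions `fⱼ` have pairwise spacelike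
separated supports, then
`⟪Ω, φ_{i₀}(f₀) ⋯ φ_{i_{n−1}}(f_{n−1}) Ω⟫ = σ · ⟪Ω, φ_{i_{n−1}}(f_{n−1}) ⋯ φ_{i₀}(f₀) Ω⟫`,
`σ = fermiPairSign` of the flags. [cite: StreaterWightman1964, §4-3 eq. (4-33)] -/
theorem cWightmanFn_eq_fermiPairSign_mul_reverse (hW : IsSpinorWightmanQFT W) {n : ℕ} (i : Fin n → W.Idx)
    (f : Fin n → 𝓢(SpaceTime 3, ℂ))
    (hsep : ∀ ⦃a b : Fin n⦄, a < b → AreSpacelikeSeparated (tsupport (f a : SpaceTime 3 → ℂ)) (tsupport (f b : SpaceTime 3 → ℂ))) :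
    W.cWightmanFn n i f =
      fermiPairSign (List.ofFn fun j => W.isFermi (i j).1) * W.cWightmanFn n (fun j => i (Fin.rev j)) (fun j => f (Fin.rev j)) := by
  have hpw : (List.ofFn fun j => (i j, f j)).Pairwise
      fun p q => AreSpacelikeSeparated (tsupport (p.2 : SpaceTime 3 → ℂ)) (tsupport (q.2 : SpaceTime 3 → ℂ)) := by
    rw [List.pairwise_ofFn]
    exact fun a b hab => hsep hab
  rw [SpinorWightmanData.cWightmanFn, SpinorWightmanData.cmonomialVec, hW.cMonomial_eq_smul_reverse _ hpw,
    Submodule.coe_smul, inner_smul_right, map_isFermi_ofFn, List.reverse_ofFn']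
  rfl

/-- The same for the dependent-index Wightman functions `wightmanFn n k α`. [cite: StreaterWightman1964, §4-3 eq. (4-33)] -/
theorem wightmanFn_eq_fermiPairSign_mul_reverse (hW : IsSpinorWightmanQFT W) {n : ℕ} (k : Fin n → κ)
    (α : (j : Fin n) → Fin (W.mult (k j))) (f : Fin n → 𝓢(SpaceTime 3, ℂ))
    (hsep : ∀ ⦃a b : Fin n⦄, a < b → AreSpacelikeSeparated (tsupport (f a : SpaceTime 3 → ℂ)) (tsupport (f b : SpaceTime 3 → ℂ))) :
    W.wightmanFn n k α f =
      fermiPairSign (List.ofFn fun j => W.isFermi (k j)) *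
        W.wightmanFn n (fun j => k (Fin.rev j)) (fun j => α (Fin.rev j)) (fun j => f (Fin.rev j)) := by
  have h := hW.cWightmanFn_eq_fermiPairSign_mul_reverse (fun j => (⟨k j, α j⟩ : W.Idx)) f hsep
  rw [W.cWightmanFn_eq_wightmanFn, W.cWightmanFn_eq_wightmanFn] at h
  exact h

end IsSpinorWightmanQFT

/-! ### Geometry of wedge configurations -/

section Geometry

variable {n : ℕ}

/-- The right wedge is closed under addition. [folklore] -/
theorem rightWedge_add {a b : SpaceTime 3} (ha : |a 0| < a 3) (hb : |b 0| < b 3) : |(a + b) 0| < (a + b) 3 := by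
  simp only [PiLp.add_apply]
  exact (abs_add_le _ _).trans_lt (add_lt_add ha hb)

/-- In a right-wedge configuration every later point is in the right wedge of every earlier one.
[cite: StreaterWightman1964, §2-4 Thm 2-12] -/
theorem sub_mem_rightWedge_of_mem_rightWedgeConfigs {x : Fin n → SpaceTime 3} (hx : x ∈ TubeBoost.rightWedgeConfigs)
    {a b : Fin n} (hab : a < b) : |(x b - x a) 0| < (x b - x a) 3 := by
  cases n with
  | zero => exact a.elim0
  | succ m =>
    -- induction on `b`
    revert a
    refine Fin.induction (motive := fun b => ∀ {a : Fin (m + 1)}, a < b → |(x b - x a) 0| < (x b - x a) 3) ?_ ?_ b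
    · intro a ha; exact absurd ha (Fin.not_lt_zero a)
    · intro j ih a ha
      have hstep : |(x j.succ - x j.castSucc) 0| < (x j.succ - x j.castSucc) 3 := by
        have h := hx j.succ (by simp)
        rwa [succDiff_succ] at h
      rcases (Fin.le_castSucc_iff.2 ha).lt_or_eq with hlt | heq
      · have h2 := ih hlt
        have e : x j.succ - x a = (x j.succ - x j.castSucc) + (x j.castSucc - x a) := by abel
        rw [e]
        exact rightWedge_add hstep h2
      · rw [heq]; exact hstep

/-- A vector in the right wedge is spacelike. [folklore] -/
theorem isSpacelike_of_mem_rightWedge {v : SpaceTime 3} (hv : |v 0| < v 3) : IsSpacelike v := by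
  rw [IsSpacelike, minkowskiForm_apply]
  have h3 : v 0 ^ 2 < v 3 ^ 2 := by
    have := abs_lt.1 hv
    nlinarith [abs_nonneg (v 0), sq_abs (v 0)]
  have hsum : v 3 * v 3 ≤ ∑ i : Fin 3, v i.succ * v i.succ := by
    rw [Fin.sum_univ_three]
    show v 3 * v 3 ≤ v 1 * v 1 + v 2 * v 2 + v 3 * v 3
    nlinarith [mul_self_nonneg (v 1), mul_self_nonneg (v 2)]
  nlinarith

/-- Spacelike separation is invariant under the total reflection `x ↦ −x`. [folklore] -/
theorem isSpacelikeSeparated_neg_iff (x y : SpaceTime 3) : IsSpacelikeSeparated (-x) (-y) ↔ IsSpacelikeSeparated x y := by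
  rw [IsSpacelikeSeparated, IsSpacelikeSeparated, IsSpacelike, IsSpacelike, show -x - -y = -(x - y) by abel,
    minkowskiForm_self, minkowskiForm_self, map_neg, norm_neg]
  have h : ((-(x - y) : SpaceTime 3) 0) ^ 2 = ((x - y : SpaceTime 3) 0) ^ 2 := by simp; ring
  rw [h]

/-- **Inside a box of right-wedge configurations different slots are spacelike separated, and so are
their reflections**: if `{x | ∀ j, x j ∈ B j} ⊆ 𝒥⁺` is nonempty, then for `a < b` the sets `−B_a` and
`−B_b` (and `B_a`, `B_b`) are spacelike separated. [cite: StreaterWightman1964, §2-4 Thm 2-12] -/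
theorem areSpacelikeSeparated_neg_of_box_subset {B : Fin n → Set (SpaceTime 3)} {x₀ : Fin n → SpaceTime 3}
    (hx₀ : ∀ j, x₀ j ∈ B j) (hB : {x : Fin n → SpaceTime 3 | ∀ j, x j ∈ B j} ⊆ TubeBoost.rightWedgeConfigs)
    {a b : Fin n} (hab : a < b) :
    AreSpacelikeSeparated ((fun y => -y) ⁻¹' B a) ((fun y => -y) ⁻¹' B b) := by
  intro p hp q hq
  -- the configuration `x₀` with slots `a`, `b` replaced by `−p`, `−q` lies in the box
  classical
  set u : Fin n → SpaceTime 3 := Function.update (Function.update x₀ a (-p)) b (-q) with hu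
  have hub : u b = -q := by simp [hu]
  have hua : u a = -p := by
    rw [hu, Function.update_of_ne hab.ne, Function.update_self]
  have humem : u ∈ TubeBoost.rightWedgeConfigs := by
    refine hB fun j => ?_
    by_cases hjb : j = b
    · subst hjb; rw [hub]; exact hq
    · by_cases hja : j = a
      · subst hja; rw [hua]; exact hp
      · simp only [hu, Function.update_of_ne hjb, Function.update_of_ne hja]; exact hx₀ j
  have h := sub_mem_rightWedge_of_mem_rightWedgeConfigs humem hab
  rw [hub, hua, show -q - -p = p - q by abel] at h
  exact isSpacelike_of_mem_rightWedge h

/-- A box of right-wedge configurations around a given right-wedge configuration: `𝒥⁺` is open.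
[folklore] -/
theorem exists_ball_box_subset_rightWedgeConfigs {x₀ : Fin n → SpaceTime 3} (hx₀ : x₀ ∈ TubeBoost.rightWedgeConfigs) :
    ∃ ε > 0, {x : Fin n → SpaceTime 3 | ∀ j, x j ∈ Metric.ball (x₀ j) ε} ⊆ TubeBoost.rightWedgeConfigs := by
  obtain ⟨ε, hε, hball⟩ := Metric.isOpen_iff.1 TubeBoost.isOpen_rightWedgeConfigs x₀ hx₀
  refine ⟨ε, hε, fun x hx => hball ?_⟩
  rw [Metric.mem_ball, dist_pi_lt_iff hε]
  exact fun j => hx j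

end Geometry

/-! ### Local totality of tensor products -/

section LocalDensity

variable {n : ℕ}

/-- **Local tensor products suffice for a continuous functional** (per-argument regions): if a
continuous linear functional `L` on `𝒮((ℝ⁴)ⁿ)` vanishes on the tensor products `⊗ fⱼ` of compactly
supported test functions with `supp fⱼ ⊆ 𝒪ⱼ`, `𝒪ⱼ` open, then `L F = 0` for every compactly supported
`F` supported in `{x | xⱼ ∈ 𝒪ⱼ ∀ j}` (cutoffs `θⱼ ∈ C_c^∞(𝒪ⱼ)` equal to `1` near the projections of
`supp F`, `F = (⊗θⱼ) · F`, and totality of tensor products; the functional form of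
`IsSpinorVectorDistributionOf.apply_eq_zero_of_tsupport_subset_pi`). [folklore] -/
theorem clm_eq_zero_of_tsupport_subset_box (L : 𝓢((Fin n → SpaceTime 3), ℂ) →L[ℂ] ℂ)
    {O : Fin n → Set (SpaceTime 3)} (hO : ∀ j, IsOpen (O j))
    (h0 : ∀ (f : Fin n → 𝓢(SpaceTime 3, ℂ)) (G : 𝓢((Fin n → SpaceTime 3), ℂ)), IsTensorOf G f →
      (∀ j, HasCompactSupport (f j : SpaceTime 3 → ℂ) ∧ tsupport (f j : SpaceTime 3 → ℂ) ⊆ O j) → L G = 0)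
    (F : 𝓢((Fin n → SpaceTime 3), ℂ)) (hFc : HasCompactSupport (F : (Fin n → SpaceTime 3) → ℂ))
    (hFO : tsupport (F : (Fin n → SpaceTime 3) → ℂ) ⊆ {x | ∀ j, x j ∈ O j}) : L F = 0 := by
  -- the coordinate projections of the support and cutoffs `θⱼ = 1` on them
  set K : Fin n → Set (SpaceTime 3) := fun j => (fun x : Fin n → SpaceTime 3 => x j) ''
    tsupport (F : (Fin n → SpaceTime 3) → ℂ) with hK
  have hKc : ∀ j, IsCompact (K j) := fun j => hFc.image (continuous_apply j)
  have hKO : ∀ j, K j ⊆ O j := by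
    rintro j y ⟨x, hx, rfl⟩
    exact hFO hx j
  choose θ hθs hθc hθO hθ1 _ using fun j =>
    SchwartzSupport.exists_smooth_one_of_isCompact_subset_isOpen (hKc j) (hO j) (hKO j)
  -- the complex one-variable cutoffs and the tensor cutoff
  set θc : Fin n → SpaceTime 3 → ℂ := fun j y => ((θ j y : ℝ) : ℂ) with hθc_def
  have hθcs : ∀ j, ContDiff ℝ ∞ (θc j) := fun j => Complex.ofRealCLM.contDiff.comp (hθs j)
  have hθcc : ∀ j, HasCompactSupport (θc j) := fun j => (hθc j).comp_left Complex.ofReal_zero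
  have hθcg : ∀ j, (θc j).HasTemperateGrowth := fun j => (hθcc j).hasTemperateGrowth (hθcs j)
  have hθct : ∀ j, tsupport (θc j) ⊆ O j := fun j =>
    (closure_mono (Function.support_comp_subset Complex.ofReal_zero (θ j))).trans (hθO j)
  set m : (Fin n → SpaceTime 3) → ℂ := fun x => ∏ j, θc j (x j) with hm_def
  have hms : ContDiff ℝ ∞ m :=
    contDiff_prod fun j _ => (hθcs j).comp (contDiff_pi.1 contDiff_id j)
  have hmc : HasCompactSupport m := by
    refine HasCompactSupport.of_support_subset_isCompact (isCompact_univ_pi fun j : Fin n => hθcc j)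
      fun x hx => ?_
    rw [Function.mem_support, hm_def, Finset.prod_ne_zero_iff] at hx
    exact fun j _ => subset_tsupport _ (hx j (Finset.mem_univ j))
  have hmg : m.HasTemperateGrowth := hmc.hasTemperateGrowth hms
  -- `(⊗θ) · F = F`
  have hmF : SchwartzMap.smulLeftCLM ℂ m F = F := by
    ext x
    rw [SchwartzMap.smulLeftCLM_apply_apply hmg, smul_eq_mul]
    by_cases hx : x ∈ tsupport (F : (Fin n → SpaceTime 3) → ℂ)
    · have h1 : m x = 1 := by
        rw [hm_def]
        refine Finset.prod_eq_one fun j _ => ?_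
        simp only [hθc_def]
        rw [hθ1 j (x j) ⟨x, hx, rfl⟩, Complex.ofReal_one]
      rw [h1, one_mul]
    · rw [image_eq_zero_of_notMem_tsupport hx, mul_zero]
  -- the functional `L ∘ ((⊗θ) · )` vanishes on all tensor products, hence everywhere
  set L' : 𝓢((Fin n → SpaceTime 3), ℂ) →L[ℂ] ℂ := L.comp (SchwartzMap.smulLeftCLM ℂ m) with hL'
  have hL0 : L' = 0 := by
    refine ContinuousLinearMap.ext_on (denseSpan_tensorProducts_holds (E := SpaceTime 3) n)
      fun G hG => ?_
    obtain ⟨g, hg⟩ := hG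
    set h : Fin n → 𝓢(SpaceTime 3, ℂ) := fun j => SchwartzMap.smulLeftCLM ℂ (θc j) (ofRealTest (g j))
      with hh
    have hten : IsTensorOf (SchwartzMap.smulLeftCLM ℂ m G) h := by
      intro x
      rw [SchwartzMap.smulLeftCLM_apply_apply hmg, smul_eq_mul, hg x, hm_def]
      dsimp only
      rw [← Finset.prod_mul_distrib]
      refine Finset.prod_congr rfl fun j _ => ?_
      rw [hh]
      dsimp only
      rw [SchwartzMap.smulLeftCLM_apply_apply (hθcg j), smul_eq_mul]
    have hloc : ∀ j, HasCompactSupport (h j : SpaceTime 3 → ℂ) ∧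
        tsupport (h j : SpaceTime 3 → ℂ) ⊆ O j := by
      intro j
      have hfun : (h j : SpaceTime 3 → ℂ) = fun y => θc j y • ofRealTest (g j) y := by
        funext y
        rw [hh]
        exact SchwartzMap.smulLeftCLM_apply_apply (hθcg j) _ y
      rw [hfun]
      exact ⟨(hθcc j).smul_right, (tsupport_smul_subset_left _ _).trans (hθct j)⟩
    change L' G = 0
    rw [hL', ContinuousLinearMap.comp_apply]
    exact h0 h _ hten hloc
  have h := congrArg (fun S : 𝓢((Fin n → SpaceTime 3), ℂ) →L[ℂ] ℂ => S F) hL0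
  simp only [hL', ContinuousLinearMap.comp_apply, hmF, zero_apply] at h
  exact h

end LocalDensity

end Literature.Analysis.FunctionSpaces
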